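import Summits.BirchSwinnertonDyer.BirchSwinnertonDyer.Theorems.PrintX10bControlBottomClassNonvanishing
import HarnessLib

/-!
# TURNKEY: the compact-side inputs of `stub_controlGlue` in the currency of D1's `eisensteinDVRSetting`, binder for binder
# (helper for the shared μ-crux `MuInequalityCoherentPairOfHoward`, stmt-BirchSwinnertonDyer-23088; crux of record of this
# seat `PrintX10b.BeyondCarrierDepthX10b`, stmt-23055)

Summits-side helper; theorems only, no named fact, no `sorry`. Cell `pub/bsd-print-x9`, seat `bsd-line-x10b-p1-w2` g9 (C9).

`Stmt.controlGlue` of the registered skeleton (`Cruxes/MuInequalityCoherentPair/Lines/spec_witnesses.lean`, v4 on 23088)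
quantifies, for `m ≥ m₁`, over `S hpS hbad L hL hLS jbar' cd Dd fs t ht I hy` and assumes
`(W.eisensteinDVRSetting (κ.unitTwist (-1)) hm S hpS hbad L hL hLS jbar' cd Dd fs).Conclusion hy (ctrlLevel … z)`, whose clause
(i) is `St.T.IsFreeRankOneOn (St.T.limitSelmer fun k ↦ (St.t k).cond) x`. This file restates the packages
`PrintX10bCompactControl.exists_forall_finite_coker_and_natCard_le_and_ne_zero` (p659161) in exactly that currency —
`St.T` instead of `κ⁻.eisensteinAdicTowerSucc …` (equal by `eisensteinDVRSetting_T`, `rfl`), `(St.t k).cond` instead of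
`F_𝔮 (k+1)` (`eisensteinDVRSetting_t_cond`, `rfl`), an ARBITRARY transition datum `t, ht` (collapsed inside the proof by
`eq_torsionGaloisModuleReduce`) and the CONSUMER PREAMBLE of `ZpExtensionEisensteinDVRSetting` — so that the compact
half of the stub is ONE application: **`exists_forall_compactInputs_eisensteinDVRSetting`** gives `n₁ m₂` (from `D, z`
alone) such that for every `m` with `p^{n₁} < m`, `m₂ ≤ m` and all the stub's binders, `hfree` (Conclusion (i)) and
`hf : f_m(𝔖) ⊆ H¹_{F_𝔮}` imply `Finite (H_m ⧸ range f̂_m)`, `Nat.card (H_m ⧸ range f̂_m) ≤ p^{p^{n₁}}` and `f_m z ≠ 0`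
(`H_m := ↥(I.selmerSubmodule F_𝔮 _)` with any `Λ`-compatible `S_m`-structure, `f̂_m` the co-restriction of
`toEisensteinH1Linear`). HONEST FRAMING: bookkeeping over p659161/p660565; no summit statement is proved; BSD is not
proved by any of this.

References: B. Howard, Compositio Math. 140 (2004), Thm. 1.6.1 (a), Prop. 2.2.8, proof of Thm. 2.2.10 (𝔮 = T^m + p).
-/

set_option linter.dupNamespace false
set_option autoImplicit false

noncomputable section

open scoped TensorProduct ContRepresentation Classical

namespace Summit.BirchSwinnertonDyer.BirchSwinnertonDyer.Theorems.PrintX10bCompactControl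

open Literature WeierstrassCurve Literature.NumberTheory.EllipticCurves Literature.NumberTheory.GaloisRepresentations
open IsDedekindDomain Literature.NumberTheory.GaloisRepresentations.DiscreteGaloisModule
open Literature.NumberTheory.EllipticCurves.ZpExtension Literature.NumberTheory.GaloisCohomology.Howard2004
open Literature.NumberTheory.GaloisCohomology
open scoped NumberField

set_option synthInstance.maxHeartbeats 80000 in
set_option maxHeartbeats 800000 in
/-- **The compact-side inputs of `stub_controlGlue`, in the stub's own currency.** See the module docstring.
[cite: Howard2004HeegnerKolyvagin, Thm. 1.6.1 (a), Prop. 2.2.8 and proof of Thm. 2.2.10 (𝔮 = T^m + p)]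
[cite: MazurRubinMemoirs2004, Prop. 5.3.14] -/
theorem exists_forall_compactInputs_eisensteinDVRSetting (W : WeierstrassCurve ℚ) [W.IsElliptic]
    (K : Type) [Field K] [NumberField K] (p : ℕ) [hp : Fact p.Prime] (κ : ZpExtension K p)
    (γ : Field.absoluteGaloisGroup K) (D : (W.baseChange K).LambdaAdicSelmerData κ γ)
    [Module.Finite (IwasawaAlgebra p) D.S] (hγ : κ.IsTopGenerator γ)
    (hE : ∀ P : (W.baseChange K).toAffine.Point, p • P = 0 → P = 0) (z : D.S) (hz : z ≠ 0)
    (htor : Module.IsTorsion (IwasawaAlgebra p) (D.S ⧸ (IwasawaAlgebra p) ∙ z)) :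
    ∃ n₁ m₂ : ℕ, ∀ (m : ℕ) (hm : 1 ≤ m), p ^ n₁ < m → m₂ ≤ m →
      letI := IwasawaAlgebra.isDomain_quotient_X_pow_add_C p hm
      letI := IwasawaAlgebra.isDiscreteValuationRing_quotient_X_pow_add_C p hm
      haveI := IwasawaAlgebra.EisensteinCoeff.isLocalRing_succ p hm
      letI := IwasawaAlgebra.EisensteinCoeff.algebraOfSpecSucc p m
      haveI := W.isScalarTower_algebraOfSpecSucc (K := K) (p := p) (m := m)
      letI := W.residueModuleSucc (K := K) (p := p) hm
      ∀ (S : Finset (IsDedekindDomain.HeightOneSpectrum (NumberField.RingOfIntegers K)))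
        (hpS : ∀ v, ((p : ℕ) : NumberField.RingOfIntegers K) ∈ v.asIdeal → v ∈ S)
        (hbad : ∀ v, v ∉ S → ((p : ℕ) : NumberField.RingOfIntegers K) ∉ v.asIdeal →
          (W.baseChange K).HasGoodReductionAt v)
        (L : Set (IsDedekindDomain.HeightOneSpectrum (NumberField.RingOfIntegers K)))
        (hL : L ⊆ (W.eisensteinTower (κ.unitTwist (-1)) hm).degreeTwoPrimes p)
        (hLS : ∀ v ∈ L, v ∉ S) (jbar' : AlgebraicClosure K →+* ℂ) (cd : ConjugationDatum K)
        (Dd : ∀ k, DualityDatum p cd ((W.eisensteinTower (κ.unitTwist (-1)) hm).ρ k)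
          (IwasawaAlgebra.EisensteinCoeff p m (k + 1)))
        (fs : ∀ (k : ℕ) (n : Finset (IsDedekindDomain.HeightOneSpectrum (NumberField.RingOfIntegers K)))
          (v : IsDedekindDomain.HeightOneSpectrum (NumberField.RingOfIntegers K)),
          galoisCohomology ((W.eisensteinLevelQuot (κ.unitTwist (-1)) hm k n).toLocal (Sum.inr v)) 1 →+
            SingularQuotient (GaloisRep.toLocal v (W.eisensteinLevelQuot (κ.unitTwist (-1)) hm k n)) ⊗[ℤ]
              Gell v)
        (t : ∀ k, ((W.baseChange K).torsionGaloisModule ((p : ℤ) ^ (k + 1))).toContRepresentation →ⁱL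
          ((W.baseChange K).torsionGaloisModule ((p : ℤ) ^ k)).toContRepresentation)
        (ht : ∀ k (P : geomTorsion (W.baseChange K) ((p : ℤ) ^ (k + 1))),
          t k P = (W.baseChange K).geomTorsionReduce p k P)
        (I : ZpExtension.EisensteinH1Data (κ.unitTwist (-1))
          (fun k ↦ (W.baseChange K).torsionGaloisModule ((p : ℤ) ^ k)) t hm)
        [Module (IwasawaAlgebra p ⧸
          Ideal.span {(PowerSeries.X ^ m + PowerSeries.C (p : ℤ_[p]) : IwasawaAlgebra p)})
          ↥(I.selmerSubmodule
            ((κ.unitTwist (-1)).eisensteinSelmerStructure (fun k ↦ (W.baseChange K).torsionGaloisModule ((p : ℤ) ^ k))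
              t hm S (fun v _ ↦ (W.baseChange K).ordinaryFiltrationAt v t ht))
            (fun k c x hx ↦ (κ.unitTwist (-1)).map_eisensteinTwistSMulHom_mem_selmerGroup
              (fun k ↦ (W.baseChange K).torsionGaloisModule ((p : ℤ) ^ k)) t hm S
              (fun v _ ↦ (W.baseChange K).ordinaryFiltrationAt v t ht) k c x hx))]
        [IsScalarTower (IwasawaAlgebra p) (IwasawaAlgebra p ⧸
          Ideal.span {(PowerSeries.X ^ m + PowerSeries.C (p : ℤ_[p]) : IwasawaAlgebra p)})
          ↥(I.selmerSubmodule
            ((κ.unitTwist (-1)).eisensteinSelmerStructure (fun k ↦ (W.baseChange K).torsionGaloisModule ((p : ℤ) ^ k))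
              t hm S (fun v _ ↦ (W.baseChange K).ordinaryFiltrationAt v t ht))
            (fun k c x hx ↦ (κ.unitTwist (-1)).map_eisensteinTwistSMulHom_mem_selmerGroup
              (fun k ↦ (W.baseChange K).torsionGaloisModule ((p : ℤ) ^ k)) t hm S
              (fun v _ ↦ (W.baseChange K).ordinaryFiltrationAt v t ht) k c x hx))]
        (hf : ∀ s : D.S, D.toEisensteinH1Linear hm t ht I hγ hE s ∈
          I.ordinarySelmer S (fun v _ ↦ (W.baseChange K).ordinaryFiltrationAt v t ht))
        (x : ∀ k, galoisCohomology
          ((W.eisensteinDVRSetting (κ.unitTwist (-1)) hm S hpS hbad L hL hLS jbar' cd Dd fs).T.ρ k) 1),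
        (W.eisensteinDVRSetting (κ.unitTwist (-1)) hm S hpS hbad L hL hLS jbar' cd Dd fs).T.IsFreeRankOneOn
            ((W.eisensteinDVRSetting (κ.unitTwist (-1)) hm S hpS hbad L hL hLS jbar' cd Dd fs).T.limitSelmer
              fun k ↦ ((W.eisensteinDVRSetting (κ.unitTwist (-1)) hm S hpS hbad L hL hLS jbar' cd Dd fs).t k).cond) x →
        (Finite (↥(I.selmerSubmodule
              ((κ.unitTwist (-1)).eisensteinSelmerStructure (fun k ↦ (W.baseChange K).torsionGaloisModule ((p : ℤ) ^ k))
                t hm S (fun v _ ↦ (W.baseChange K).ordinaryFiltrationAt v t ht))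
              (fun k c x hx ↦ (κ.unitTwist (-1)).map_eisensteinTwistSMulHom_mem_selmerGroup
                (fun k ↦ (W.baseChange K).torsionGaloisModule ((p : ℤ) ^ k)) t hm S
                (fun v _ ↦ (W.baseChange K).ordinaryFiltrationAt v t ht) k c x hx)) ⧸
            LinearMap.range ((D.toEisensteinH1Linear hm t ht I hγ hE).codRestrict _ hf)) ∧
          Nat.card (↥(I.selmerSubmodule
              ((κ.unitTwist (-1)).eisensteinSelmerStructure (fun k ↦ (W.baseChange K).torsionGaloisModule ((p : ℤ) ^ k))
                t hm S (fun v _ ↦ (W.baseChange K).ordinaryFiltrationAt v t ht))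
              (fun k c x hx ↦ (κ.unitTwist (-1)).map_eisensteinTwistSMulHom_mem_selmerGroup
                (fun k ↦ (W.baseChange K).torsionGaloisModule ((p : ℤ) ^ k)) t hm S
                (fun v _ ↦ (W.baseChange K).ordinaryFiltrationAt v t ht) k c x hx)) ⧸
            LinearMap.range ((D.toEisensteinH1Linear hm t ht I hγ hE).codRestrict _ hf)) ≤ p ^ (p ^ n₁)) ∧
        D.toEisensteinH1Linear hm t ht I hγ hE z ≠ 0 := by
  obtain ⟨n₁, m₂, hpkg⟩ := exists_forall_finite_coker_and_natCard_le_and_ne_zero D hγ hE z hz htor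
  refine ⟨n₁, m₂, fun m hm hn₁m hm₂m ↦ ?_⟩
  intro S hpS hbad L hL hLS jbar' cd Dd fs t ht I _ _ hf x hfree
  obtain rfl := eq_torsionGaloisModuleReduce t ht
  exact hpkg hm I S hf x hfree hn₁m hm₂m


/-- **`one ≠ 0` from `f_m z ≠ 0`**: the family `(I.proj (k+1) h)_k` (the skeleton's `ctrlLevel … z` for `h = f_m z`) is
non-zero as soon as `h ≠ 0` (`EisensteinH1Data.injective_projSucc`). Generic in the pin.
[cite: Howard2004HeegnerKolyvagin, §2.2 (T_𝔮 = lim T_𝔮/p^k T_𝔮)] -/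
theorem proj_succ_ne_zero {K : Type} [Field K] {p : ℕ} [Fact p.Prime] {κ : ZpExtension K p}
    {M : ℕ → Type} [∀ k, AddCommGroup (M k)] [∀ k, TopologicalSpace (M k)] [∀ k, DiscreteTopology (M k)]
    {ρ : ∀ k, DiscreteGaloisModule K (M k)}
    {t : ∀ k, (ρ (k + 1)).toContRepresentation →ⁱL (ρ k).toContRepresentation} {m : ℕ} {hm : 1 ≤ m}
    (I : ZpExtension.EisensteinH1Data κ ρ t hm) (ht : ∀ k, Function.Surjective (t k)) {h : I.H} (hh : h ≠ 0) :
    (fun k ↦ I.proj (k + 1) h) ≠ 0 := by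
  intro h0
  apply hh
  letI := IwasawaAlgebra.isLocalRing_quotient_X_pow_add_C p hm
  exact (injective_iff_map_eq_zero _).1 (I.injective_projSucc ht) h h0

set_option synthInstance.maxHeartbeats 80000 in
/-- **`hone_mem` in the stub's currency**: for `h ∈ H¹_{F_𝔮}(K, T_𝔮)` (pinned `ordinarySelmer`, e.g. `h = f_m s` by `hf`), the family
`(I.proj (k+1) h)_k` lies in `St.T.limitSelmer (k ↦ (St.t k).cond)` for `St = W.eisensteinDVRSetting (κ.unitTwist (-1)) hm …`
(`projSucc_mem_limitSelmer_of_mem_ordinarySelmer`, read through `eisensteinDVRSetting_T` / `_t_cond`).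
[cite: Howard2004HeegnerKolyvagin, §1.6 (arXiv p. 12, L29–55) and Def. 3.1.2] -/
theorem proj_succ_mem_limitSelmer_eisensteinDVRSetting (W : WeierstrassCurve ℚ) [W.IsElliptic]
    (K : Type) [Field K] [NumberField K] (p : ℕ) [hp : Fact p.Prime] (κ : ZpExtension K p) {m : ℕ} (hm : 1 ≤ m) :
    letI := IwasawaAlgebra.isDomain_quotient_X_pow_add_C p hm
    letI := IwasawaAlgebra.isDiscreteValuationRing_quotient_X_pow_add_C p hm
    haveI := IwasawaAlgebra.EisensteinCoeff.isLocalRing_succ p hm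
    letI := IwasawaAlgebra.EisensteinCoeff.algebraOfSpecSucc p m
    haveI := W.isScalarTower_algebraOfSpecSucc (K := K) (p := p) (m := m)
    letI := W.residueModuleSucc (K := K) (p := p) hm
    ∀ (S : Finset (IsDedekindDomain.HeightOneSpectrum (NumberField.RingOfIntegers K)))
      (hpS : ∀ v, ((p : ℕ) : NumberField.RingOfIntegers K) ∈ v.asIdeal → v ∈ S)
      (hbad : ∀ v, v ∉ S → ((p : ℕ) : NumberField.RingOfIntegers K) ∉ v.asIdeal →
        (W.baseChange K).HasGoodReductionAt v)
      (L : Set (IsDedekindDomain.HeightOneSpectrum (NumberField.RingOfIntegers K)))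
      (hL : L ⊆ (W.eisensteinTower (κ.unitTwist (-1)) hm).degreeTwoPrimes p)
      (hLS : ∀ v ∈ L, v ∉ S) (jbar' : AlgebraicClosure K →+* ℂ) (cd : ConjugationDatum K)
      (Dd : ∀ k, DualityDatum p cd ((W.eisensteinTower (κ.unitTwist (-1)) hm).ρ k)
        (IwasawaAlgebra.EisensteinCoeff p m (k + 1)))
      (fs : ∀ (k : ℕ) (n : Finset (IsDedekindDomain.HeightOneSpectrum (NumberField.RingOfIntegers K)))
        (v : IsDedekindDomain.HeightOneSpectrum (NumberField.RingOfIntegers K)),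
        galoisCohomology ((W.eisensteinLevelQuot (κ.unitTwist (-1)) hm k n).toLocal (Sum.inr v)) 1 →+
          SingularQuotient (GaloisRep.toLocal v (W.eisensteinLevelQuot (κ.unitTwist (-1)) hm k n)) ⊗[ℤ]
            Gell v)
      (t : ∀ k, ((W.baseChange K).torsionGaloisModule ((p : ℤ) ^ (k + 1))).toContRepresentation →ⁱL
        ((W.baseChange K).torsionGaloisModule ((p : ℤ) ^ k)).toContRepresentation)
      (ht : ∀ k (P : geomTorsion (W.baseChange K) ((p : ℤ) ^ (k + 1))),
        t k P = (W.baseChange K).geomTorsionReduce p k P)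
      (I : ZpExtension.EisensteinH1Data (κ.unitTwist (-1))
        (fun k ↦ (W.baseChange K).torsionGaloisModule ((p : ℤ) ^ k)) t hm)
      {h : I.H}, h ∈ I.ordinarySelmer S (fun v _ ↦ (W.baseChange K).ordinaryFiltrationAt v t ht) →
      (fun k ↦ I.proj (k + 1) h) ∈
        (W.eisensteinDVRSetting (κ.unitTwist (-1)) hm S hpS hbad L hL hLS jbar' cd Dd fs).T.limitSelmer
          fun k ↦ ((W.eisensteinDVRSetting (κ.unitTwist (-1)) hm S hpS hbad L hL hLS jbar' cd Dd fs).t k).cond := by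
  intro S hpS hbad L hL hLS jbar' cd Dd fs t ht I h hh
  obtain rfl := eq_torsionGaloisModuleReduce t ht
  exact I.projSucc_mem_limitSelmer_of_mem_ordinarySelmer
    (fun k ↦ (W.baseChange K).torsionGaloisModuleReduce_surjective p k) S _ hh

end Summit.BirchSwinnertonDyer.BirchSwinnertonDyer.Theorems.PrintX10bCompactControl

end
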